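import Literature.NumberTheory.LFunctions.Brent1979Reduction
import HarnessLib

/-!
# `H`-statements at a height: all zeros of `ζ` with `0 < Im ρ ≤ T` are simple and on the critical line

Topic `Literature/NumberTheory/LFunctions` (trunk T-ANT with T-VALNUM). The named, height-parametrised form of
the conclusion of every classical verification of the Riemann hypothesis (Brent's `H(n)`: "the first `n` zeros
of `ζ(s)` are simple and lie on the critical line" [Brent1979, §1]), stated at a HEIGHT `T` rather than at an
index `n` so that it composes with `Literature.NumberTheory.DiophantineGeometry.RiemannHypothesisUpTo T`
(which it implies and which forgets simplicity):

* `ZetaZerosSimpleOnLineUpTo T` — the Prop; antitone in `T`; implies `RiemannHypothesisUpTo T`.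
* `ZetaZerosSimpleOnLineUpTo.of_located_zeros` — Brent's `H(n)` criterion (`N(T) ≤ #located zeros on the
  line below `T`), from `simple_onLine_upTo_of_located_zeros`.
* `ZetaZerosSimpleOnLineUpTo.of_hardyZ_signs` — **the certificate-backed form at any height `T > 168π`**:
  certified strict sign changes of Hardy's `Z` at finitely many points below `T` and on `[T, T + h]`, plus ONE
  explicit real inequality (Turing's method in the integral form with the Turing–Lehman bound
  `|∫ S| ≤ 2.30 + 0.128 log(t₂/2π)`, which is PROVED in the tree:
  `Literature.NumberTheory.LFunctions.abs_integral_zetaArgS_le_turing_holds`), give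
  `ZetaZerosSimpleOnLineUpTo T ∧ N(T) = n ∧ N₀(T) = n`. All analysis is discharged; the hypotheses are exactly
  the data of a numerical verification (sample abscissae, certified signs, one inequality) — the format of the
  rh-explicit verify track's certificates (HOME/verify/p1/STEP0-VERIFY-PROTOCOL.md §5).
* `Brent1979_zerosSimpleOnLine_of_upTo` — Brent's named fact
  `Literature.NumberTheory.LFunctions.Brent1979_zerosSimpleOnLine` from the Prop at any `T ≥ 32 585 736.4`.
* (The instance `T = 2516` is `zeros_simple_onLine_upTo_2516`, `RiemannHypothesisUpTo2516.lean`, which carries that file's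
  `native_decide` auxiliary axioms and is therefore not restated here.)

## References

* [Brent1979] R. P. Brent, *On the zeros of the Riemann zeta function in the critical strip*, Math. Comp. 33
  (1979) 1361–1372: §1 (`H(n)`), §3 Theorems 3.1–3.2, §4.
* [EdwardsZeta1974] H. M. Edwards, *Riemann's Zeta Function*, 1974, §8.2 (Turing's method, eq. (1)).
-/

noncomputable section

open Complex Finset
open scoped Real

namespace Literature.NumberTheory.LFunctions

/-- **All zeros of `ζ` up to height `T` are simple and on the critical line**: every `ρ` with `ζ(ρ) = 0`
and `0 < Im ρ ≤ T` has `Re ρ = ½` and `ζ'(ρ) ≠ 0`. Height form of Brent's `H(n)` ("the first `n` zeros of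
`ζ(s)` are simple and lie on the critical line"). [cite: Brent1979, §1] -/
def ZetaZerosSimpleOnLineUpTo (T : ℝ) : Prop :=
  ∀ ρ : ℂ, riemannZeta ρ = 0 → 0 < ρ.im → ρ.im ≤ T → ρ.re = 1 / 2 ∧ deriv riemannZeta ρ ≠ 0

/-- `ZetaZerosSimpleOnLineUpTo` is antitone in the height. [cite: Brent1979, §1] -/
theorem ZetaZerosSimpleOnLineUpTo.anti : Antitone ZetaZerosSimpleOnLineUpTo :=
  fun _ _ hTT' h ρ hρ h0 hT ↦ h ρ hρ h0 (hT.trans hTT')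

/-- `ZetaZerosSimpleOnLineUpTo T` implies the named hypothesis `RiemannHypothesisUpTo T` (forget
simplicity). [cite: Brent1979, §1] -/
theorem ZetaZerosSimpleOnLineUpTo.riemannHypothesisUpTo {T : ℝ} (h : ZetaZerosSimpleOnLineUpTo T) :
    DiophantineGeometry.RiemannHypothesisUpTo T :=
  fun ρ hρ h0 hT ↦ (h ρ hρ h0 hT).1

/-- Under `ZetaZerosSimpleOnLineUpTo T` the two counting functions agree: `N₀(T) = N(T)`.
[cite: Brent1979, §4] -/
theorem ZetaZerosSimpleOnLineUpTo.criticalZeroCount_eq {T : ℝ} (h : ZetaZerosSimpleOnLineUpTo T) :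
    criticalZeroCount T = zetaZeroCount T :=
  (DiophantineGeometry.riemannHypothesisUpTo_iff_criticalZeroCount_eq T).1 h.riemannHypothesisUpTo

/-- **Brent's `H(n)` criterion at a height.** If `Z` is a finite set of ordinates `0 < γ ≤ T` of zeros of
`ζ` on the critical line with `N(T) ≤ |Z|`, then `ZetaZerosSimpleOnLineUpTo T` and `N(T) = |Z|`.
[cite: Brent1979, §4 (N(g_n) = n + 1, hence H(n + 1))] -/
theorem ZetaZerosSimpleOnLineUpTo.of_located_zeros {T : ℝ} (Z : Finset ℝ)
    (hZ : ∀ γ ∈ Z, riemannZeta (1 / 2 + γ * I) = 0 ∧ 0 < γ ∧ γ ≤ T) (hN : zetaZeroCount T ≤ Z.card) :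
    ZetaZerosSimpleOnLineUpTo T ∧ zetaZeroCount T = Z.card := by
  obtain ⟨hall, hcount⟩ := simple_onLine_upTo_of_located_zeros Z hZ hN
  exact ⟨fun ρ h0 h1 h2 ↦ ⟨(hall ρ h0 h1 h2).1, (hall ρ h0 h1 h2).2.1⟩, hcount⟩

/-- **The certificate-backed form (Turing's method with simplicity, all analysis discharged).** Let
`168π < T` and `0 < h`. Certified strict sign changes of Hardy's `Z` along `0 ≤ t₀ < ⋯ < t_n ≤ T` and along
`T ≤ s₀ < ⋯ < s_m ≤ T + h`, together with the single explicit inequality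
`2.30 + 0.128 log((T + h)/2π) + ∫_T^{T+h} (θ(t)/π + 1) dt − Σ_{j<m} (T + h − s_{j+1}) < h (n + 1)`,
imply: every zero of `ζ` with `0 < Im ρ ≤ T` is simple and on the critical line, and `N(T) = N₀(T) = n`.
This is `simple_onLine_upTo_of_turing` with the Turing–Lehman bound for `∫ S` supplied by its proof in the
tree (`abs_integral_zetaArgS_le_turing_holds`); what remains as hypotheses is exactly the data of a
verification run. [cite: Brent1979, §3 Theorems 3.1–3.2 and §4] [cite: EdwardsZeta1974, §8.2 (1)] -/
theorem ZetaZerosSimpleOnLineUpTo.of_hardyZ_signs {T h : ℝ} {n m : ℕ} (hT : 168 * π < T) (hh : 0 < h)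
    (t : Fin (n + 1) → ℝ) (ht : StrictMono t) (ht0 : 0 ≤ t 0) (htn : t (Fin.last n) ≤ T)
    (htsign : ∀ i : Fin n, hardyZ (t i.castSucc) * hardyZ (t i.succ) < 0)
    (s : Fin (m + 1) → ℝ) (hs : StrictMono s) (hs0 : T ≤ s 0) (hsm : s (Fin.last m) ≤ T + h)
    (hssign : ∀ i : Fin m, hardyZ (s i.castSucc) * hardyZ (s i.succ) < 0)
    (hnum : 2.30 + 0.128 * Real.log ((T + h) / (2 * π))
        + (∫ t in T..T + h, (riemannSiegelTheta t / π + 1)) - ∑ i : Fin m, (T + h - s i.succ)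
        < h * (n + 1)) :
    ZetaZerosSimpleOnLineUpTo T ∧ zetaZeroCount T = n ∧ criticalZeroCount T = n :=
  simple_onLine_upTo_of_turing hh.le t ht ht0 htn htsign s hs hs0 hsm hssign
    (abs_le.1 (abs_integral_zetaArgS_le_turing_holds hT (by linarith))).2 hnum

/-- Brent's named fact `Brent1979_zerosSimpleOnLine` (zeros with `0 < Im ρ < 32 585 736.4` simple and on the
line) from `ZetaZerosSimpleOnLineUpTo T` at any `T ≥ 32 585 736.4`. [cite: Brent1979, Abstract] -/
theorem Brent1979_zerosSimpleOnLine_of_upTo {T : ℝ} (hT : 32585736.4 ≤ T)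
    (h : ZetaZerosSimpleOnLineUpTo T) : Brent1979_zerosSimpleOnLine :=
  Brent1979_zerosSimpleOnLine_of_forall_le hT h

end Literature.NumberTheory.LFunctions
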